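/-
Copyright: the b2b-balaban T⁴-continuum CRUX team, row NE7b OWNER lineage `t4-ne7b-p1` (gen 107). Project licence.
-/
import Summits.QuantumFields.BalabanUV.T4Continuum.Spine.NE7b.CarrierOnSupport

/-!
# THE SPLIT AT THE CONVEXITY RADIUS (Δ4-num): a road bound on `K_N ∩ K` plus POSITIVITY on the large-field complement `K_N ∖ K` —
# `∫_{K_N} e^{−V} ∕ ∫_{K_D} e^{−W} ≤ e^{b} + vol(K_N ∖ K)·e^{−E} ∕ γ ≤ exp(b + vol(K_N ∖ K)·e^{−E−b} ∕ γ)` — and `LocCondStability` BY NAME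
# for the split carrier (row NE7b, node U5c; residual (R2′) family (2), the refuter's κ-ne7bref-g68-3 as a kernel theorem; plumbing)

Cell `pub-balaban`, sub-cell `t4`, spine estimate NE7b (`T4WeightBudget.RelWeightBound`; the cell's OWN estimate — NOT PRINTED in
[Bałaban 1983–89], NOT PROVED).  Crux-route work under `Spine/NE7b/` by the row's OWNER; NOTHING of Bałaban's is named or asserted;
no `T4Continuum/Support` leaf typed; no `def`; zero `sorry`.

WHY.  The convexity road (`…NE7b.ConvexTiltMoment`, `…NE7b.ConvexWindowTiltMoment`) prices the numerator of a one-step carrier ON a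
convex window `K` where the exponent is uniformly convex.  The refuter located the residual of the ROAD (PRICING-NE7b v72 F395,
κ-ne7bref-g68-3 = Δ4-num): after the Chernoff extraction the numerator's support `K_N` on the pinned region need not sit inside the
exponent's CONVEXITY RADIUS — for a compact-group action in the chart `1 − cos u` is convex only for `|u| ≤ π∕2` —, so the road needs
the numerator windowed from above by a convex `K`, «with the complement `{some |gX_p| > π∕2 on Z}` paid by POSITIVITY at
`e^{−(1−cos(π∕2))∕g²}` per plaquette against the budget — IF the carrier affords that second split».  RULING W-ne7bp1-g106-4 found
print's mechanism ((h): at 𝐑-steps the hierarchy of small-field conditions windows the numerator inside the radius with room, so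
`K_N ⊆ K` and `…ConvexWindowTiltLCS`'s nesting suffices; (n): at the creation level positivity alone).  THIS FILE types the SECOND
SPLIT itself as a kernel theorem, so that the road is complete in kind whichever reading the instance takes: over ANY measure space,
`∫_{K_N} e^{−V} = ∫_{K_N ∩ K} e^{−V} + ∫_{K_N ∖ K} e^{−V}`; the first piece is the ROAD's (an abstract hypothesis
`∫_{K_N ∩ K} e^{−V} ≤ e^{b}·∫_{K_D} e^{−W}` — supplied by the windowed road on the convex `K_N ∩ K` and monotonicity, or by any other
road); the second is POSITIVITY: a floor `E ≤ V` on `K_N ∖ K` of finite volume gives `≤ vol(K_N ∖ K)·e^{−E}`, measured against a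
window-mass floor `γ ≤ ∫_{K_D} e^{−W}` of the denominator.

WHAT IS PROVED ([folklore]; Bochner additivity ∕ monotonicity, `exp` algebra, the gen-105 `locCondStability_of_carrier_le_on_support`):
* §1 `setIntegral_exp_neg_le_of_floor` (any measure: `E ≤ V` on `S`, `μ S < ∞` ⟹ `∫_S e^{−V} ≤ μ(S)·e^{−E}`),
  `setIntegral_eq_inter_add_sdiff` (the split).
* §2 **`splitCarrier_le`**: `∫_{K_N} e^{−V} ∕ ∫_{K_D} e^{−W} ≤ e^{b} + μ(K_N ∖ K)·e^{−E} ∕ γ`; `exp_add_le_exp_add_mul_exp_neg`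
  (`e^{b} + t ≤ exp(b + t·e^{−b})`) and **`splitCarrier_le_exp`**: `≤ exp(b + μ(K_N ∖ K)·e^{−E}·e^{−b} ∕ γ)`.
* §3 **`locCondStability_of_splitCarrier_on_support`**: the junction BY NAME for the split carrier
  `M j g y = ∫_{K_N} e^{−V} ∕ ∫_{K_D} e^{−W}` on background-dependent fibres `(F j g, κ j g)`, with the road bound, the floor `E j g`, the
  complement volume bound `v j g` and the denominator floor `γ j g` displayed `y`-uniformly on the support of the term; budget
  `b j g + v j g · e^{−E j g} · e^{−b j g} ∕ γ j g`.

NOT HERE (honest): the convexity radius, the floor `E` (print's `(1 − cos(π∕2))∕g²`-type positivity per plaquette), the complement's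
volume and the denominator's window mass for Bałaban's steps ((A1c)∕(A3) readings; Q-ne7bref-g68-1's (h)∕(c)∕(n)); the road bound
itself (`…ConvexWindowTiltMoment` ∕ `…ConvexWindowTiltLCS`); anything of Bałaban's.  NE7b NOT PRINTED ∕ NOT PROVED; spine PROVED 0∕9;
rung (B)+1 on a FINITE torus — NOT infinite volume, NOT the mass gap, NOT Clay.
HONEST DEPENDENCY: continuum YM on T⁴ ⇐ BetaPertH ∧ nine spine estimates (0/9 proved); BetaPertH ⇐ (D1) ∧ (D4) ∧ CAP+tail.
-/

set_option autoImplicit false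

noncomputable section

open MeasureTheory Real Set
open Summit.QuantumFields.BalabanUV.T4Continuum.B16HistoryIndexedRepr Summit.QuantumFields.BalabanUV.T4Continuum.B16HistoryReprChain
open Summit.QuantumFields.BalabanUV.T4Continuum.NE7b.PrefixExtraction Summit.QuantumFields.BalabanUV.T4Continuum.NE7b.LocalConditionalStability
open Summit.QuantumFields.BalabanUV.T4Continuum.NE7b.CarrierOnSupport

namespace Summit.QuantumFields.BalabanUV.T4Continuum.NE7b.ConvexityRadiusSplit

/-! ## §1 Positivity on a set of finite volume, and the split of the numerator -/

section AnyMeasure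

variable {X : Type*} [MeasurableSpace X] (μ : Measure X)

/-- **POSITIVITY WITH A FLOOR**: if `E ≤ V` on a measurable set `S` of finite measure then `∫_S e^{−V} dμ ≤ μ(S)·e^{−E}` (if `e^{−V}`
is not integrable on `S` the left side is `0` by convention and the bound holds all the same). [folklore] -/
theorem setIntegral_exp_neg_le_of_floor {V : X → ℝ} {S : Set X} {E : ℝ} (hSm : MeasurableSet S) (hS : μ S ≠ ⊤)
    (hfl : ∀ x ∈ S, E ≤ V x) : ∫ x in S, exp (-V x) ∂μ ≤ μ.real S * exp (-E) := by
  by_cases hint : IntegrableOn (fun x => exp (-V x)) S μ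
  · calc ∫ x in S, exp (-V x) ∂μ ≤ ∫ x in S, exp (-E) ∂μ :=
          setIntegral_mono_on hint (integrableOn_const hS) hSm fun x hx => exp_le_exp.2 (by linarith [hfl x hx])
      _ = μ.real S * exp (-E) := by rw [setIntegral_const, smul_eq_mul]
  · rw [integral_undef hint]
    exact mul_nonneg measureReal_nonneg (exp_pos _).le

/-- The split of a set integral along a measurable `K`: `∫_S f = ∫_{S ∩ K} f + ∫_{S ∖ K} f`. [folklore] -/
theorem setIntegral_eq_inter_add_sdiff {f : X → ℝ} {S K : Set X} (hKm : MeasurableSet K) (hf : IntegrableOn f S μ) :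
    ∫ x in S, f x ∂μ = ∫ x in S ∩ K, f x ∂μ + ∫ x in S \ K, f x ∂μ :=
  (integral_inter_add_sdiff hKm hf).symm

/-! ## §2 The split carrier: road on `K_N ∩ K`, positivity on `K_N ∖ K` -/

/-- **THE SPLIT CARRIER IS AT MOST `e^{b} + μ(K_N ∖ K)·e^{−E} ∕ γ`.**  Any measure space; `K` measurable; `e^{−V}` integrable on
`K_N`; the ROAD bound `∫_{K_N ∩ K} e^{−V} ≤ e^{b}·∫_{K_D} e^{−W}` (abstract — the convexity road on the convex part, or any other); a
FLOOR `E ≤ V` on the complement `K_N ∖ K` of finite measure; a denominator floor `0 < γ ≤ ∫_{K_D} e^{−W}`. [folklore] -/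
theorem splitCarrier_le {V W : X → ℝ} {KN K KD : Set X} {b E γ : ℝ} (hKNm : MeasurableSet KN) (hKm : MeasurableSet K)
    (hVN : IntegrableOn (fun x => exp (-V x)) KN μ) (hvol : μ (KN \ K) ≠ ⊤) (hfl : ∀ x ∈ KN \ K, E ≤ V x)
    (hroad : ∫ x in KN ∩ K, exp (-V x) ∂μ ≤ exp b * ∫ x in KD, exp (-W x) ∂μ) (hγ : 0 < γ)
    (hden : γ ≤ ∫ x in KD, exp (-W x) ∂μ) :
    (∫ x in KN, exp (-V x) ∂μ) / (∫ x in KD, exp (-W x) ∂μ) ≤ exp b + μ.real (KN \ K) * exp (-E) / γ := by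
  set D := ∫ x in KD, exp (-W x) ∂μ with hD
  have hDpos : 0 < D := lt_of_lt_of_le hγ hden
  have hsplit := setIntegral_eq_inter_add_sdiff μ hKm hVN
  have hfar := setIntegral_exp_neg_le_of_floor μ (hKNm.diff hKm) hvol hfl
  have hT0 : 0 ≤ μ.real (KN \ K) * exp (-E) := mul_nonneg measureReal_nonneg (exp_pos _).le
  rw [div_le_iff₀ hDpos, hsplit, add_mul]
  have h2 : μ.real (KN \ K) * exp (-E) ≤ μ.real (KN \ K) * exp (-E) / γ * D := by
    rw [div_mul_eq_mul_div, le_div_iff₀ hγ]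
    exact mul_le_mul_of_nonneg_left hden hT0
  linarith

/-- `e^{b} + t ≤ exp(b + t·e^{−b})` (tangent line of `exp` at `0`, scaled by `e^{b}`; any real `t`). [folklore] -/
theorem exp_add_le_exp_add_mul_exp_neg (b t : ℝ) : exp b + t ≤ exp (b + t * exp (-b)) := by
  have h1 : 1 + t * exp (-b) ≤ exp (t * exp (-b)) := by linarith [add_one_le_exp (t * exp (-b))]
  have e : exp b + t = exp b * (1 + t * exp (-b)) := by
    rw [mul_add, mul_one, mul_left_comm, ← exp_add, add_neg_cancel, exp_zero, mul_one]
  rw [e, exp_add]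
  exact mul_le_mul_of_nonneg_left h1 (exp_pos _).le

/-- **THE SPLIT CARRIER IN BUDGET FORM**: under the hypotheses of `splitCarrier_le`,
`∫_{K_N} e^{−V} ∕ ∫_{K_D} e^{−W} ≤ exp(b + μ(K_N ∖ K)·e^{−E}·e^{−b} ∕ γ)`. [folklore] -/
theorem splitCarrier_le_exp {V W : X → ℝ} {KN K KD : Set X} {b E γ : ℝ} (hKNm : MeasurableSet KN) (hKm : MeasurableSet K)
    (hVN : IntegrableOn (fun x => exp (-V x)) KN μ) (hvol : μ (KN \ K) ≠ ⊤) (hfl : ∀ x ∈ KN \ K, E ≤ V x)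
    (hroad : ∫ x in KN ∩ K, exp (-V x) ∂μ ≤ exp b * ∫ x in KD, exp (-W x) ∂μ) (hγ : 0 < γ)
    (hden : γ ≤ ∫ x in KD, exp (-W x) ∂μ) :
    (∫ x in KN, exp (-V x) ∂μ) / (∫ x in KD, exp (-W x) ∂μ) ≤ exp (b + μ.real (KN \ K) * exp (-E) * exp (-b) / γ) := by
  refine (splitCarrier_le μ hKNm hKm hVN hvol hfl hroad hγ hden).trans ?_
  have h := exp_add_le_exp_add_mul_exp_neg b (μ.real (KN \ K) * exp (-E) / γ)
  have e : b + μ.real (KN \ K) * exp (-E) / γ * exp (-b) = b + μ.real (KN \ K) * exp (-E) * exp (-b) / γ := by ring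
  rwa [e] at h

/-- The split carrier is non-negative. [folklore] -/
theorem splitCarrier_nonneg (V W : X → ℝ) (KN KD : Set X) :
    0 ≤ (∫ x in KN, exp (-V x) ∂μ) / ∫ x in KD, exp (-W x) ∂μ :=
  div_nonneg (integral_nonneg fun _ => (exp_pos _).le) (integral_nonneg fun _ => (exp_pos _).le)

end AnyMeasure

/-! ## §3 The junction: `LocCondStability` by name for the split carrier, from data displayed on the support -/

section Junction

variable {P : Type} [DecidableEq P] {C : ℕ → Type} {𝒢 : (j : ℕ) → GoodClass (C j)}

/-- **LCS FOR A BACKGROUND-DEPENDENT SPLIT CARRIER, ON THE SUPPORT.**  At every pattern prefix `g` of a level `j < K` and every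
background `y` let `M j g y = (∫_{K_N} e^{−V} dκ) ∕ (∫_{K_D} e^{−W} dκ)` on a fibre `(F j g, κ j g)` — windows `K_N j g y`, `Kc j g y`
(the convexity window), `K_D j g y`, exponents `V j g y`, `W j g y` —; suppose `M j g` is a.e.-strongly measurable and ON THE SUPPORT
OF THE TERM: `K_N`, `Kc` measurable, `e^{−V}` integrable on `K_N`; the ROAD bound `∫_{K_N ∩ Kc} e^{−V} ≤ e^{b j g}·∫_{K_D} e^{−W}`; the
FLOOR `E j g ≤ V` on `K_N ∖ Kc`, whose volume is at most `v j g`; the denominator floor `0 < γ j g ≤ ∫_{K_D} e^{−W}` — all four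
letters `y`-UNIFORM.  Then `LocCondStability T S K μ ρ₀ M b'` with `b' j g = b j g + v j g·e^{−E j g}·e^{−b j g} ∕ γ j g`, integrability
conjunct included. [folklore] -/
theorem locCondStability_of_splitCarrier_on_support (T : Tower P C 𝒢) (Spat : (j : ℕ) → (Fin j → P) → Finset P)
    (K : ℕ) [∀ j, MeasurableSpace (C j)] (μ : (j : ℕ) → Measure (C j)) (ρ₀ : C 0 → ℝ)
    (M : (j : ℕ) → (Fin j → P) → C j → ℝ)
    (F : (j : ℕ) → (Fin j → P) → Type) [∀ j g, MeasurableSpace (F j g)] (κ : (j : ℕ) → (g : Fin j → P) → Measure (F j g))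
    (KN Kc KD : (j : ℕ) → (g : Fin j → P) → C j → Set (F j g))
    (V W : (j : ℕ) → (g : Fin j → P) → C j → F j g → ℝ)
    (b E v γ : (j : ℕ) → (Fin j → P) → ℝ) (hρ : (𝒢 0).Gd ρ₀) (h0 : ∀ x, 0 ≤ ρ₀ x)
    (hM : ∀ j g, j < K → g ∈ admS T Spat j → ∀ y, M j g y =
      (∫ x in KN j g y, exp (-V j g y x) ∂κ j g) / ∫ x in KD j g y, exp (-W j g y x) ∂κ j g)
    (hMm : ∀ j g, j < K → g ∈ admS T Spat j → AEStronglyMeasurable (M j g) (μ j))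
    (hKNm : ∀ j g, j < K → g ∈ admS T Spat j → ∀ y, T.eterm ρ₀ j g y ≠ 0 → MeasurableSet (KN j g y))
    (hKcm : ∀ j g, j < K → g ∈ admS T Spat j → ∀ y, T.eterm ρ₀ j g y ≠ 0 → MeasurableSet (Kc j g y))
    (hVN : ∀ j g, j < K → g ∈ admS T Spat j → ∀ y, T.eterm ρ₀ j g y ≠ 0 →
      IntegrableOn (fun x => exp (-V j g y x)) (KN j g y) (κ j g))
    (hvol : ∀ j g, j < K → g ∈ admS T Spat j → ∀ y, T.eterm ρ₀ j g y ≠ 0 →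
      (κ j g) (KN j g y \ Kc j g y) ≠ ⊤ ∧ (κ j g).real (KN j g y \ Kc j g y) ≤ v j g)
    (hfl : ∀ j g, j < K → g ∈ admS T Spat j → ∀ y, T.eterm ρ₀ j g y ≠ 0 → ∀ x ∈ KN j g y \ Kc j g y, E j g ≤ V j g y x)
    (hroad : ∀ j g, j < K → g ∈ admS T Spat j → ∀ y, T.eterm ρ₀ j g y ≠ 0 →
      ∫ x in KN j g y ∩ Kc j g y, exp (-V j g y x) ∂κ j g ≤ exp (b j g) * ∫ x in KD j g y, exp (-W j g y x) ∂κ j g)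
    (hγ : ∀ j g, j < K → g ∈ admS T Spat j → 0 < γ j g)
    (hden : ∀ j g, j < K → g ∈ admS T Spat j → ∀ y, T.eterm ρ₀ j g y ≠ 0 →
      γ j g ≤ ∫ x in KD j g y, exp (-W j g y x) ∂κ j g)
    (hint : ∀ j g, j < K → g ∈ admS T Spat j → Integrable (T.eterm ρ₀ j g) (μ j)) :
    LocCondStability T Spat K μ ρ₀ M (fun j g => b j g + v j g * exp (-E j g) * exp (-b j g) / γ j g) := by
  refine locCondStability_of_carrier_le_on_support T Spat K μ ρ₀ M _ hρ h0 hMm (fun j g hj hg y => ?_)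
    (fun j g hj hg y hy => ?_) hint
  · rw [hM j g hj hg y]
    exact splitCarrier_nonneg _ _ _ _ _
  · rw [hM j g hj hg y]
    refine (splitCarrier_le_exp (κ j g) (hKNm j g hj hg y hy) (hKcm j g hj hg y hy) (hVN j g hj hg y hy)
      (hvol j g hj hg y hy).1 (hfl j g hj hg y hy) (hroad j g hj hg y hy) (hγ j g hj hg) (hden j g hj hg y hy)).trans
      (exp_le_exp.2 ?_)
    have hc : 0 ≤ exp (-E j g) * exp (-b j g) / γ j g :=
      div_nonneg (mul_nonneg (exp_pos _).le (exp_pos _).le) (hγ j g hj hg).le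
    have hmono := mul_le_mul_of_nonneg_right (hvol j g hj hg y hy).2 hc
    have e1 : (κ j g).real (KN j g y \ Kc j g y) * exp (-E j g) * exp (-b j g) / γ j g =
        (κ j g).real (KN j g y \ Kc j g y) * (exp (-E j g) * exp (-b j g) / γ j g) := by ring
    have e2 : v j g * exp (-E j g) * exp (-b j g) / γ j g = v j g * (exp (-E j g) * exp (-b j g) / γ j g) := by ring
    rw [e1, e2]
    linarith

end Junction

end Summit.QuantumFields.BalabanUV.T4Continuum.NE7b.ConvexityRadiusSplit

end
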